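import Literature.MathematicalPhysics.QuantumLattice.AnisotropicXYLayeredThermalExplicit
import Literature.MathematicalPhysics.QuantumLattice.AnisotropicKLSCauchySchwarz
import HarnessLib

/-!
# Unconditional long-range order of the quantum XY / hard-core-boson model with direction-dependent
# couplings on `ℤ³`: every `K > 0` with `2 max K ≤ Σᵢ Kᵢ`, every spin; the layered model for all
# interlayer couplings `0 < r ≤ 2`

Topic `MathematicalPhysics/QuantumLattice`; the assembly on top of `AnisotropicKLSIntegral.lean`
(long-range order of `H_K = -Σ_xΣᵢ Kᵢ(S¹_xS¹_{x+eᵢ} + S²_xS²_{x+eᵢ})` conditional on the single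
inequality `I_K < S√2`), `AnisotropicKLSPairDomination.lean` (the one-variable function
`H(y) = y₊(2/(1-y))^{1/2}` with `F_K = H(C_K/κ_K)`, convex below `1`) and
`AnisotropicKLSIntegralBound.lean` (the pair integral `I_{(1,1)} < 1/√2` and the layered reduction
`I_{(1,1,r)} ≤ I_{(1,1)}`; `AnisotropicXYLayeredThermalExplicit.lean` for an explicit `β₀(r)`,
`r ≤ 1`). No definition, no named fact.

* **The weighted convexity reduction for arbitrary couplings on three directions.**
  Kennedy–Lieb–Shastry's argument `I(ν) ≤ I(2)` ([KLS1988PRL] p. 2584, after eq. (8): `F` convex,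
  `Y = (ν²-ν)⁻¹Σ_{i≠j}Y_{ij}`, Jensen) needs only that the weight vector `K/κ_K` be a convex
  combination of pair midpoints `½(eᵢ + eⱼ)`; on three directions this holds exactly when
  `2K_k ≤ κ_K` for every `k`, with the explicit weights `1 - 2K_k/κ_K` on the pair `{k}ᶜ`. Jensen
  for the convex `H` gives `F_K(p) ≤ Σ_k (1 - 2K_k/κ_K) F_{(1,1)}(p with p_k deleted)` off the null
  set where some `cos pᵢ = 1` (`anisoKlsIntegrand_three_le_sum`); Tonelli at each deleted
  coordinate (`setLIntegral_box_comp_succAbove`) gives `∫_{[-π,π]³} F_K ≤ 2π∫_{[-π,π]²} F_{(1,1)}`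
  (`lintegral_anisoKlsIntegrand_three_le`), i.e. **`I_K ≤ I_{(1,1)}`**
  (`anisoKlsIntegral_three_le_two`) and, by `anisoKlsIntegral_two_lt`, **`I_K < 1/√2`**
  (`anisoKlsIntegral_three_lt`) for every `K` with `κ_K > 0` and `2 max K ≤ κ_K` — the layered
  `K = (1,1,r)`, `0 ≤ r ≤ 2`, of `anisoKlsIntegral_layered_lt` being the case `K₀ = K₁`.
* **Long-range order, unconditional** (`d = 3`): for every `K > 0` with `2 max K ≤ Σᵢ Kᵢ` and every
  spin `S = n/2 ≥ ½`, ground-state long-range order on the even tori `(ℤ/2kℤ)³`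
  (`xyAniso_longRangeOrder_ground_three`) and long-range order of the Gibbs states for all
  `β ≥ β₀` (`xyAniso_longRangeOrder_thermal_three`); for the **layered model** in the tree's
  vocabulary `layeredCoupling 1 r = (1, 1, r)` (`layeredCoupling_one_eq` of
  `AnisotropicXYLayeredThermalExplicit.lean`), **every `0 < r ≤ 2` and
  every spin** (`xyLayered_longRangeOrder`) — Kennedy–Lieb–Shastry's layered model of [KLS1988JSP]
  §3 in its XY / hard-core-boson version at `T = 0` and, as announced on p. 1020 (methods of
  Dyson–Lieb–Simon), at `T > 0`; this supersedes the tree's partial results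
  `xyLayered_longRangeOrder_spin_ge_one` (`S ≥ 1`, `r ≥ 1/100`) and
  `xyLayered_longRangeOrder_of_latticeGreen_le` (`S = ½`, `½ ≤ r ≤ 1`, modulo Watson's integral).
* **An explicit floor on the ground-state order parameter** (Kennedy–Lieb–Shastry's eq. (7) in the
  infinite-volume limit): `liminf_k |Λ_k|⁻² Σ_{x,y∈Λ_k}⟨S¹_xS¹_y + S²_xS²_y⟩ ≥ n²/4 - n I_K/(2√2)`
  for `d ≥ 3`, `K > 0`, `I_K < S√2` (`xyAniso_groundOrderParameter_ge`); on three directions with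
  `2 max K ≤ Σ K`: `≥ n²/4 - n(1/8 + 3823/(10080π))` (`xyAniso_groundOrderParameter_ge_three`), and
  for the layered hard-core-boson model (`S = ½`, every `0 < r ≤ 2`):
  **`≥ 1/8 - 3823/(10080π) = 0.0042…`** (`xyLayered_groundOrderParameter_ge_spinHalf`,
  `layered_groundOrderParameter_floor_pos`; saturation value `S² = ¼`); at low temperature
  (`β ≥ β₀`) half of it: `liminf ≥ n²/8 - nρ/(4√2)` for every `ρ > I_K`
  (`xyAniso_thermalOrderParameter_ge`), on three directions `≥ n²/8 - 869n√2/10000`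
  (`xyAniso_thermalOrderParameter_ge_three`), layered `S = ½`: **`≥ 1/8 - 869√2/10000 = 0.0021…`**
  (`xyLayered_thermalOrderParameter_ge_spinHalf`).

## References

* [KLS1988PRL] T. Kennedy, E. H. Lieb, B. S. Shastry, *The XY model has long-range order for all
  spins and all dimensions greater than one*, Phys. Rev. Lett. 61 (1988) 2582–2584, Theorem, eq. (8)
  and the paragraph after it (p. 2584).
* [KLS1988JSP] T. Kennedy, E. H. Lieb, B. S. Shastry, *Existence of Néel order in some spin-½
  Heisenberg antiferromagnets*, J. Stat. Phys. 53 (1988) 1019–1030, §3, eqs. (5)–(9), p. 1020.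
* [DLS1978] F. J. Dyson, E. H. Lieb, B. Simon, J. Stat. Phys. 18 (1978) 335–383, Thms. 5.1–5.2.
-/

noncomputable section

open MeasureTheory Set Filter Topology
open scoped ENNReal
open Literature.MathematicalPhysics.QuantumLattice Literature.Probability.LatticeModels
  Literature.MathematicalPhysics.QuantumLattice.XYOrderProofs

namespace Literature.MathematicalPhysics.QuantumLattice

/-! ### The weighted convexity reduction `I_K ≤ I_{(1,1)}` on three directions -/

section Reduction

/-- `F_K` is measurable (local copy of the private lemma of `AnisotropicKLSIntegralBound.lean`).
[cite: KLS1988PRL, eq. (8)] -/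
private theorem anisoKlsIntegrand_measurable {d : ℕ} (K : Fin d → ℝ) :
    Measurable (anisoKlsIntegrand K) := by
  unfold anisoKlsIntegrand anisoCosSum NVectorAniso.anisoDispersion
  refine Measurable.mul ?_ (Real.continuous_sqrt.measurable.comp ?_)
  · exact (Finset.measurable_sum _ fun i _ =>
      (Real.measurable_cos.comp (measurable_pi_apply i)).const_mul _).max measurable_const
  · exact measurable_const.div (measurable_const.mul (Finset.measurable_sum _ fun i _ =>
      (measurable_const.sub (Real.measurable_cos.comp (measurable_pi_apply i))).const_mul _))

/-- The pair integrand at a general point of `ℝ²`: `F_{(1,1)}(q) = H(½(cos q₀ + cos q₁))`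
(`anisoKlsIntegrand_two_eq_klsH` with `q = (q₀, q₁)`). [cite: KLS1988PRL, eq. (8)] -/
private theorem anisoKlsIntegrand_two_eq_klsH' (q : Fin 2 → ℝ) :
    anisoKlsIntegrand ![(1 : ℝ), 1] q =
      max ((Real.cos (q 0) + Real.cos (q 1)) / 2) 0 *
        Real.sqrt (2 / (1 - (Real.cos (q 0) + Real.cos (q 1)) / 2)) := by
  have hq : ![q 0, q 1] = q := by
    ext i
    fin_cases i <;> rfl
  have h := anisoKlsIntegrand_two_eq_klsH (q 0) (q 1)
  rwa [hq] at h

/-- **Discrete Jensen, weighted pair form on three directions**: if all `cos pᵢ < 1`, `κ_K > 0` and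
`2K_k ≤ κ_K` for every `k`, then
`F_K(p) ≤ Σ_k (1 - 2K_k/κ_K) F_{(1,1)}(p with p_k deleted)`, because
`C_K(p)/κ_K = Σ_k (1 - 2K_k/κ_K) · ½(cos pᵢ + cos pⱼ)` (`{i,j} = {k}ᶜ`) is a convex combination of
the three pair averages, which are `< 1`, and `H` is convex below `1` (`convexOn_klsH`). (For
`K = (1,1,r)` the weights are `(2-r)/(2+r), r/(2+r), r/(2+r)`: `anisoKlsIntegrand_layered_le_pairs`.)
[cite: KLS1988PRL, after eq. (8)] -/
theorem anisoKlsIntegrand_three_le_sum {K : Fin 3 → ℝ} (hκ : 0 < ∑ i, K i)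
    (h2 : ∀ i, 2 * K i ≤ ∑ j, K j) (p : Fin 3 → ℝ) (hp : ∀ i, Real.cos (p i) < 1) :
    anisoKlsIntegrand K p ≤
      ∑ k : Fin 3, (1 - 2 * K k / ∑ i, K i) *
        anisoKlsIntegrand ![(1 : ℝ), 1] (fun j => p (k.succAbove j)) := by
  set κ : ℝ := ∑ i, K i with hκ_def
  have hmem : ∀ k ∈ (Finset.univ : Finset (Fin 3)),
      (fun k : Fin 3 => (Real.cos (p (k.succAbove 0)) + Real.cos (p (k.succAbove 1))) / 2) k ∈
        Iio (1 : ℝ) := by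
    intro k _
    show (Real.cos (p (k.succAbove 0)) + Real.cos (p (k.succAbove 1))) / 2 < 1
    linarith [hp (k.succAbove 0), hp (k.succAbove 1)]
  have hw0 : ∀ k ∈ (Finset.univ : Finset (Fin 3)), 0 ≤ (fun k : Fin 3 => 1 - 2 * K k / κ) k := by
    intro k _
    dsimp only
    rw [sub_nonneg, div_le_one hκ]
    exact h2 k
  have hκ3 : κ = K 0 + K 1 + K 2 := by rw [hκ_def, Fin.sum_univ_three]
  have hκne : K 0 + K 1 + K 2 ≠ 0 := by rw [← hκ3]; exact hκ.ne'
  have hw1 : ∑ k, (fun k : Fin 3 => 1 - 2 * K k / κ) k = 1 := by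
    simp only [Fin.sum_univ_three]
    rw [hκ3]
    field_simp
    ring
  have hJ := convexOn_klsH.map_sum_le hw0 hw1 hmem
  have e00 : (0 : Fin 3).succAbove 0 = 1 := by decide
  have e01 : (0 : Fin 3).succAbove 1 = 2 := by decide
  have e10 : (1 : Fin 3).succAbove 0 = 0 := by decide
  have e11 : (1 : Fin 3).succAbove 1 = 2 := by decide
  have e20 : (2 : Fin 3).succAbove 0 = 0 := by decide
  have e21 : (2 : Fin 3).succAbove 1 = 1 := by decide
  have hbary : ∑ k, (fun k : Fin 3 => 1 - 2 * K k / κ) k •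
      (fun k : Fin 3 => (Real.cos (p (k.succAbove 0)) + Real.cos (p (k.succAbove 1))) / 2) k =
        anisoCosSum K p / κ := by
    simp only [smul_eq_mul, Fin.sum_univ_three, e00, e01, e10, e11, e20, e21, anisoCosSum]
    rw [hκ3]
    field_simp
    ring
  rw [hbary] at hJ
  rw [anisoKlsIntegrand_eq_klsH hκ]
  refine hJ.trans (le_of_eq (Finset.sum_congr rfl fun k _ => ?_))
  rw [smul_eq_mul, anisoKlsIntegrand_two_eq_klsH']

/-- **The one-step bound** `∫_{[-π,π]³} F_K ≤ 2π ∫_{[-π,π]²} F_{(1,1)}` (`κ_K > 0`, `2 max K ≤ κ_K`):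
the weighted pair Jensen inequality (a.e., `ae_forall_cos_apply_lt_one`) and Tonelli at each
deleted coordinate (`setLIntegral_box_comp_succAbove`), the weights summing to `1`.
[cite: KLS1988PRL, after eq. (8)] -/
theorem lintegral_anisoKlsIntegrand_three_le {K : Fin 3 → ℝ} (hκ : 0 < ∑ i, K i)
    (h2 : ∀ i, 2 * K i ≤ ∑ j, K j) :
    ∫⁻ p in Set.pi univ (fun _ : Fin 3 => Icc (-Real.pi) Real.pi),
        ENNReal.ofReal (anisoKlsIntegrand K p) ≤
      ENNReal.ofReal (2 * Real.pi) *
        ∫⁻ q in Set.pi univ (fun _ : Fin 2 => Icc (-Real.pi) Real.pi),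
          ENNReal.ofReal (anisoKlsIntegrand ![(1 : ℝ), 1] q) := by
  set w : Fin 3 → ℝ := fun k => 1 - 2 * K k / ∑ i, K i with hw
  have hw0 : ∀ k, 0 ≤ w k := fun k => by
    rw [hw]
    dsimp only
    rw [sub_nonneg, div_le_one hκ]
    exact h2 k
  have hw1 : ∑ k, w k = 1 := by
    have hκ3 : ∑ i, K i = K 0 + K 1 + K 2 := Fin.sum_univ_three _
    have hκne : K 0 + K 1 + K 2 ≠ 0 := by rw [← hκ3]; exact hκ.ne'
    simp only [hw, Fin.sum_univ_three]
    field_simp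
    ring
  have hmeas : ∀ k : Fin 3, Measurable fun p : Fin 3 → ℝ =>
      ENNReal.ofReal (anisoKlsIntegrand ![(1 : ℝ), 1] (fun j => p (k.succAbove j))) :=
    fun k => ENNReal.measurable_ofReal.comp ((anisoKlsIntegrand_measurable _).comp
      (measurable_pi_lambda _ fun j => measurable_pi_apply _))
  have hae := ae_restrict_of_ae (s := Set.pi univ (fun _ : Fin 3 => Icc (-Real.pi) Real.pi))
    (ae_forall_cos_apply_lt_one 3)
  calc ∫⁻ p in Set.pi univ (fun _ : Fin 3 => Icc (-Real.pi) Real.pi),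
        ENNReal.ofReal (anisoKlsIntegrand K p)
      ≤ ∫⁻ p in Set.pi univ (fun _ : Fin 3 => Icc (-Real.pi) Real.pi),
          ENNReal.ofReal (∑ k : Fin 3, w k *
            anisoKlsIntegrand ![(1 : ℝ), 1] (fun j => p (k.succAbove j))) :=
        lintegral_mono_ae (hae.mono fun p hp =>
          ENNReal.ofReal_le_ofReal (anisoKlsIntegrand_three_le_sum hκ h2 p hp))
    _ = ∫⁻ p in Set.pi univ (fun _ : Fin 3 => Icc (-Real.pi) Real.pi),
          ∑ k : Fin 3, ENNReal.ofReal (w k) *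
            ENNReal.ofReal (anisoKlsIntegrand ![(1 : ℝ), 1] (fun j => p (k.succAbove j))) := by
        refine lintegral_congr fun p => ?_
        rw [ENNReal.ofReal_sum_of_nonneg fun k _ => mul_nonneg (hw0 k) (anisoKlsIntegrand_nonneg _ _)]
        exact Finset.sum_congr rfl fun k _ => ENNReal.ofReal_mul (hw0 k)
    _ = ∑ k : Fin 3, ENNReal.ofReal (w k) *
          ∫⁻ p in Set.pi univ (fun _ : Fin 3 => Icc (-Real.pi) Real.pi),
            ENNReal.ofReal (anisoKlsIntegrand ![(1 : ℝ), 1] (fun j => p (k.succAbove j))) := by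
        rw [lintegral_finsetSum _ fun k _ => (hmeas k).const_mul _]
        exact Finset.sum_congr rfl fun k _ => lintegral_const_mul _ (hmeas k)
    _ = ∑ k : Fin 3, ENNReal.ofReal (w k) * (ENNReal.ofReal (2 * Real.pi) *
          ∫⁻ q in Set.pi univ (fun _ : Fin 2 => Icc (-Real.pi) Real.pi),
            ENNReal.ofReal (anisoKlsIntegrand ![(1 : ℝ), 1] q)) :=
        Finset.sum_congr rfl fun k _ => by
          congr 1
          exact setLIntegral_box_comp_succAbove k
            (f := fun q => ENNReal.ofReal (anisoKlsIntegrand ![(1 : ℝ), 1] q))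
            (ENNReal.measurable_ofReal.comp (anisoKlsIntegrand_measurable _))
    _ = ENNReal.ofReal (2 * Real.pi) *
          ∫⁻ q in Set.pi univ (fun _ : Fin 2 => Icc (-Real.pi) Real.pi),
            ENNReal.ofReal (anisoKlsIntegrand ![(1 : ℝ), 1] q) := by
        rw [← Finset.sum_mul, ← ENNReal.ofReal_sum_of_nonneg (fun k _ => hw0 k), hw1,
          ENNReal.ofReal_one, one_mul]

/-- **`I_K ≤ I_{(1,1)}`** on three directions for `κ_K > 0`, `2 max K ≤ κ_K` — the weighted form of
Kennedy–Lieb–Shastry's `I(3) ≤ I(2)` (the layered case `K = (1,1,r)` is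
`anisoKlsIntegral_layered_le_two`). [cite: KLS1988PRL, after eq. (8)] -/
theorem anisoKlsIntegral_three_le_two {K : Fin 3 → ℝ} (hκ : 0 < ∑ i, K i)
    (h2 : ∀ i, 2 * K i ≤ ∑ j, K j) :
    anisoKlsIntegral K ≤ anisoKlsIntegral ![(1 : ℝ), 1] := by
  rw [anisoKlsIntegral_eq_toReal_lintegral, anisoKlsIntegral_eq_toReal_lintegral]
  have hfin : ∫⁻ q in Set.pi univ (fun _ : Fin 2 => Icc (-Real.pi) Real.pi),
      ENNReal.ofReal (anisoKlsIntegrand ![(1 : ℝ), 1] q) < ∞ :=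
    lintegral_anisoKlsIntegrand_two_le.trans_lt ENNReal.ofReal_lt_top
  have hstep := lintegral_anisoKlsIntegrand_three_le hκ h2
  have h2π : (0 : ℝ) < 2 * Real.pi := by positivity
  have hmono := ENNReal.toReal_mono (ENNReal.mul_ne_top ENNReal.ofReal_ne_top hfin.ne) hstep
  rw [ENNReal.toReal_ofReal_mul _ _ h2π.le] at hmono
  refine (div_le_div_of_nonneg_right hmono (by positivity)).trans (le_of_eq ?_)
  field_simp
  ring

/-- **`I_K < 1/√2`** for every `K` on three directions with `κ_K > 0` and `2 max K ≤ κ_K`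
(`I_K ≤ I_{(1,1)} ≤ √2/4 + (3823/5040)√2/π < √2/2`, `anisoKlsIntegral_two_lt`).
[cite: KLS1988PRL, after eq. (8)] [cite: KLS1988JSP, §3] -/
theorem anisoKlsIntegral_three_lt {K : Fin 3 → ℝ} (hκ : 0 < ∑ i, K i)
    (h2 : ∀ i, 2 * K i ≤ ∑ j, K j) : anisoKlsIntegral K < Real.sqrt 2 / 2 :=
  (anisoKlsIntegral_three_le_two hκ h2).trans_lt anisoKlsIntegral_two_lt

end Reduction

/-! ### Unconditional long-range order on `ℤ³` -/

section Order

/-- **Ground-state long-range order for direction-dependent couplings on `ℤ³`, unconditional**: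
for every `K > 0` with `2 max K ≤ Σᵢ Kᵢ` and every spin `S = n/2 ≥ ½`, the ground states of
`H_K = -Σ_xΣᵢ Kᵢ(S¹_xS¹_{x+eᵢ} + S²_xS²_{x+eᵢ})` on the even tori `(ℤ/2kℤ)³` have long-range order
(Kennedy–Lieb–Shastry's theorem for `H_K`, XY / hard-core-boson version; the lattice-integral
hypothesis of `xyAniso_longRangeOrder_ground_of_integral` discharged by
`anisoKlsIntegral_three_lt`, since `1/√2 ≤ n√2/2`). [cite: KLS1988PRL, Theorem, eq. (8)]
[cite: KLS1988JSP, §3] -/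
theorem xyAniso_longRangeOrder_ground_three {K : Fin 3 → ℝ} (hK : ∀ i, 0 < K i)
    (h2 : ∀ i, 2 * K i ≤ ∑ j, K j) {n : ℕ} (hn : 1 ≤ n) :
    HasEvenTorusLRO
      (fun L x y => xyAnisoGroundCorr 0 L n K x y + xyAnisoGroundCorr 1 L n K x y) := by
  have hκ : 0 < ∑ i, K i := Finset.sum_pos (fun i _ => hK i) Finset.univ_nonempty
  refine xyAniso_longRangeOrder_ground_of_integral le_rfl hK hn
    ((anisoKlsIntegral_three_lt hκ h2).trans_le ?_)
  have hn1 : (1 : ℝ) ≤ n := by exact_mod_cast hn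
  have := Real.sqrt_nonneg 2
  nlinarith

/-- **Long-range order at low temperature for direction-dependent couplings on `ℤ³`,
unconditional**: for every `K > 0` with `2 max K ≤ Σᵢ Kᵢ` and every spin `S = n/2 ≥ ½` there is
`β₀ > 0` such that for all `β ≥ β₀` the Gibbs states of `H_K` on the even tori `(ℤ/2kℤ)³` have
long-range order. [cite: DysonLiebSimon1978, Thms. 5.1, 5.2] [cite: KLS1988JSP, p. 1020]
[cite: KLS1988PRL, Theorem, eq. (8)] -/
theorem xyAniso_longRangeOrder_thermal_three {K : Fin 3 → ℝ} (hK : ∀ i, 0 < K i)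
    (h2 : ∀ i, 2 * K i ≤ ∑ j, K j) {n : ℕ} (hn : 1 ≤ n) :
    ∃ β₀ : ℝ, 0 < β₀ ∧ ∀ β : ℝ, β₀ ≤ β →
      HasEvenTorusLRO (fun L x y => xyAnisoThermalCorr β K L n x y) := by
  have hκ : 0 < ∑ i, K i := Finset.sum_pos (fun i _ => hK i) Finset.univ_nonempty
  refine xyAniso_longRangeOrder_thermal_of_integral le_rfl hK hn
    ((anisoKlsIntegral_three_lt hκ h2).trans_le ?_)
  have hn1 : (1 : ℝ) ≤ n := by exact_mod_cast hn
  have := Real.sqrt_nonneg 2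
  nlinarith

open AnisotropicRotator in
/-- The layered couplings `(1, 1, r)` with `0 ≤ r ≤ 2` satisfy `2 max K ≤ Σ K = 2 + r`.
[cite: KLS1988JSP, eq. (5)] -/
theorem layeredCoupling_two_mul_le {r : ℝ} (hr : 0 ≤ r) (hr2 : r ≤ 2) (i : Fin 3) :
    2 * layeredCoupling 1 r i ≤ ∑ j, layeredCoupling 1 r j := by
  rw [(layeredCoupling_one_sums r).1]
  unfold layeredCoupling
  split_ifs <;> linarith

open AnisotropicRotator in
/-- **Unconditional long-range order of the layered quantum XY / hard-core-boson model for every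
interlayer coupling `0 < r ≤ 2` and every spin** ([KLS1988JSP] §3, XY version; p. 1020 for
`T > 0`): for `S = n/2 ≥ ½` the ground states of
`H = -Σ_x[Σ_{i=1,2}(S¹_xS¹_{x+eᵢ} + S²_xS²_{x+eᵢ}) + r(S¹_xS¹_{x+e₃} + S²_xS²_{x+e₃})]` on the even tori
`(ℤ/2kℤ)³` have long-range order, and there is `β₀ > 0` such that the Gibbs states have long-range
order for every `β ≥ β₀` — in particular for `S = ½` (hard-core bosons at half filling) and
arbitrarily weak interlayer coupling `r > 0`. The lattice-integral input is
`anisoKlsIntegral_layered_lt_spin` (`I_{(1,1,r)} < n√2/2`, `AnisotropicKLSIntegralBound.lean`).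
[cite: KLS1988JSP, §3, Theorem and p. 1020] [cite: KLS1988PRL, Theorem]
[cite: DysonLiebSimon1978, Thm. 5.2] -/
theorem xyLayered_longRangeOrder {r : ℝ} (hr : 0 < r) (hr2 : r ≤ 2) {n : ℕ} (hn : 1 ≤ n) :
    HasEvenTorusLRO (fun L x y => xyAnisoGroundCorr 0 L n (layeredCoupling 1 r) x y +
        xyAnisoGroundCorr 1 L n (layeredCoupling 1 r) x y) ∧
      ∃ β₀ : ℝ, 0 < β₀ ∧ ∀ β : ℝ, β₀ ≤ β →
        HasEvenTorusLRO (fun L x y => xyAnisoThermalCorr β (layeredCoupling 1 r) L n x y) := by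
  have hK : ∀ i, 0 < layeredCoupling 1 r i := fun i => by
    unfold layeredCoupling; split_ifs; exacts [hr, one_pos]
  have hI : anisoKlsIntegral (layeredCoupling 1 r) < n * Real.sqrt 2 / 2 := by
    rw [layeredCoupling_one_eq]
    exact anisoKlsIntegral_layered_lt_spin hr.le hr2 hn
  exact ⟨xyAniso_longRangeOrder_ground_of_integral le_rfl hK hn hI,
    xyAniso_longRangeOrder_thermal_of_integral le_rfl hK hn hI⟩

open AnisotropicRotator in
/-- The hard-core-boson case spelled out: `S = ½` (`n = 1`), every `0 < r ≤ 2`.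
[cite: KLS1988JSP, §3, Theorem and p. 1020] -/
theorem xyLayered_longRangeOrder_spinHalf {r : ℝ} (hr : 0 < r) (hr2 : r ≤ 2) :
    HasEvenTorusLRO (fun L x y => xyAnisoGroundCorr 0 L 1 (layeredCoupling 1 r) x y +
        xyAnisoGroundCorr 1 L 1 (layeredCoupling 1 r) x y) ∧
      ∃ β₀ : ℝ, 0 < β₀ ∧ ∀ β : ℝ, β₀ ≤ β →
        HasEvenTorusLRO (fun L x y => xyAnisoThermalCorr β (layeredCoupling 1 r) L 1 x y) :=
  xyLayered_longRangeOrder hr hr2 le_rfl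

end Order

/-! ### An explicit floor on the ground-state order parameter -/

section Floor

variable {d : ℕ}

/-- `I_K ≥ 0` (the integrand is nonnegative). [cite: KLS1988PRL, eq. (8)] -/
theorem anisoKlsIntegral_nonneg (K : Fin d → ℝ) : 0 ≤ anisoKlsIntegral K :=
  div_nonneg (integral_nonneg fun p => anisoKlsIntegrand_nonneg K p) (by positivity)

/-- `√((n/2)²/2) = n√2/4`. [cite: KLS1988PRL, Theorem (`S = n/2`)] -/
private theorem sqrt_half_sq' (n : ℕ) :
    Real.sqrt (((n : ℝ) / 2) ^ 2 / 2) = n * Real.sqrt 2 / 4 := by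
  have h2 : ((n : ℝ) / 2) ^ 2 / 2 = (n * Real.sqrt 2 / 4) ^ 2 := by
    rw [div_pow, div_pow, mul_pow, Real.sq_sqrt (by norm_num : (0 : ℝ) ≤ 2)]
    ring
  rw [h2, Real.sqrt_sq (by positivity)]

/-- **An explicit floor on the ground-state order parameter** (Kennedy–Lieb–Shastry's eq. (7) in the
infinite-volume limit, for direction-dependent couplings): for `d ≥ 3`, `K > 0`, spin `S = n/2 ≥ ½`
and `I_K < S√2`, the long-range-order parameter of the ground states of `H_K` along the even tori
satisfies
`liminf_k |Λ_k|⁻² Σ_{x,y∈Λ_k} ⟨S¹_xS¹_y + S²_xS²_y⟩ ≥ 2(S²/2 - ½(S²/2)^{1/2} I_K) = n²/4 - n I_K/(2√2)`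
(the margin of `xyAniso_longRangeOrder_ground_even` for every `ρ > I_K`, then `ρ ↓ I_K` by
`anisoKlsRiemannSum_eventually_le`). [cite: KLS1988PRL, Theorem, eqs. (7)–(8)]
[cite: KLS1988JSP, §3] -/
theorem xyAniso_groundOrderParameter_ge (hd3 : 3 ≤ d) {K : Fin d → ℝ} (hK : ∀ i, 0 < K i)
    {n : ℕ} (hn : 1 ≤ n) (hI : anisoKlsIntegral K < n * Real.sqrt 2 / 2) :
    2 * (((n : ℝ) / 2) ^ 2 / 2 - 1 / 2 * Real.sqrt (((n : ℝ) / 2) ^ 2 / 2) * anisoKlsIntegral K) ≤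
      liminf (fun k : ℕ => (∑ x ∈ halfOpenBox d (2 * k), ∑ y ∈ halfOpenBox d (2 * k),
        torusPullback (fun L x y => xyAnisoGroundCorr 0 L n K x y + xyAnisoGroundCorr 1 L n K x y)
          (2 * k) x y) / ((halfOpenBox d (2 * k)).card : ℝ) ^ 2) atTop := by
  set I : ℝ := anisoKlsIntegral K with hI_def
  set c : ℝ := Real.sqrt (((n : ℝ) / 2) ^ 2 / 2) with hc_def
  set Lim : ℝ := liminf (fun k : ℕ => (∑ x ∈ halfOpenBox d (2 * k), ∑ y ∈ halfOpenBox d (2 * k),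
        torusPullback (fun L x y => xyAnisoGroundCorr 0 L n K x y + xyAnisoGroundCorr 1 L n K x y)
          (2 * k) x y) / ((halfOpenBox d (2 * k)).card : ℝ) ^ 2) atTop with hLim_def
  have hI0 : 0 ≤ I := anisoKlsIntegral_nonneg K
  have hc : 0 < c := Real.sqrt_pos.2 (by positivity)
  -- the margin for every `ρ ∈ (I_K, S√2)`
  have hρ : ∀ ρ : ℝ, I < ρ → ρ < n * Real.sqrt 2 / 2 →
      2 * (((n : ℝ) / 2) ^ 2 / 2 - 1 / 2 * c * ρ) ≤ Lim := by
    intro ρ h1 h2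
    have hR : ∀ᶠ k : ℕ in atTop, anisoKlsRiemannSum K (2 * k) ≤ ρ :=
      (anisoKlsRiemannSum_eventually_le hd3 hK (t := 2 * ρ - I) (by linarith)).mono
        fun k hk => hk.trans_eq (by rw [hI_def]; ring)
    have h := (xyAniso_longRangeOrder_ground_even (by omega) hK hn h2 hR).2
    rwa [max_eq_left (hI0.trans h1.le)] at h
  -- let `ρ ↓ I_K`
  refine le_of_forall_pos_le_add fun ε hε => ?_
  set δ : ℝ := min (ε / c) ((n * Real.sqrt 2 / 2 - I) / 2) with hδ_def
  have hδ0 : 0 < δ := lt_min (div_pos hε hc) (by linarith)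
  have hδ1 : δ ≤ ε / c := min_le_left _ _
  have hδ2 : δ ≤ (n * Real.sqrt 2 / 2 - I) / 2 := min_le_right _ _
  have h := hρ (I + δ) (by linarith) (by linarith)
  have hcδ : c * δ ≤ ε := by
    calc c * δ ≤ c * (ε / c) := mul_le_mul_of_nonneg_left hδ1 hc.le
      _ = ε := mul_div_cancel₀ ε hc.ne'
  linarith

/-- **The floor on three directions, explicit**: for every `K > 0` on `ℤ³` with `2 max K ≤ Σᵢ Kᵢ`
and every spin `S = n/2 ≥ ½`, the ground-state long-range-order parameter along the even tori is
at least `n²/4 - n(1/8 + 3823/(10080π))` (`I_K ≤ I_{(1,1)} ≤ √2/4 + (3823/5040)√2/π`); for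
`S = ½` this is `1/8 - 3823/(10080π) = 0.0042…`, for `S = 1` it is `0.508…`.
[cite: KLS1988PRL, Theorem, eqs. (7)–(8)] [cite: KLS1988JSP, §3] -/
theorem xyAniso_groundOrderParameter_ge_three {K : Fin 3 → ℝ} (hK : ∀ i, 0 < K i)
    (h2 : ∀ i, 2 * K i ≤ ∑ j, K j) {n : ℕ} (hn : 1 ≤ n) :
    (n : ℝ) ^ 2 / 4 - n * (1 / 8 + 3823 / (10080 * Real.pi)) ≤
      liminf (fun k : ℕ => (∑ x ∈ halfOpenBox 3 (2 * k), ∑ y ∈ halfOpenBox 3 (2 * k),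
        torusPullback (fun L x y => xyAnisoGroundCorr 0 L n K x y + xyAnisoGroundCorr 1 L n K x y)
          (2 * k) x y) / ((halfOpenBox 3 (2 * k)).card : ℝ) ^ 2) atTop := by
  have hκ : 0 < ∑ i, K i := Finset.sum_pos (fun i _ => hK i) Finset.univ_nonempty
  have hn1 : (1 : ℝ) ≤ n := by exact_mod_cast hn
  have hs2 := Real.sqrt_nonneg 2
  have hIlt : anisoKlsIntegral K < n * Real.sqrt 2 / 2 :=
    (anisoKlsIntegral_three_lt hκ h2).trans_le (by nlinarith)
  have hfloor := xyAniso_groundOrderParameter_ge le_rfl hK hn hIlt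
  rw [sqrt_half_sq'] at hfloor
  have hIb : anisoKlsIntegral K ≤ Real.sqrt 2 / 4 + 3823 / 5040 * Real.sqrt 2 / Real.pi :=
    (anisoKlsIntegral_three_le_two hκ h2).trans anisoKlsIntegral_two_le
  have h22 : Real.sqrt 2 ^ 2 = 2 := Real.sq_sqrt (by norm_num)
  have hπ := Real.pi_pos
  have hid : (n : ℝ) ^ 2 / 4 - n * (1 / 8 + 3823 / (10080 * Real.pi)) =
      2 * (((n : ℝ) / 2) ^ 2 / 2 - 1 / 2 * (n * Real.sqrt 2 / 4) *
        (Real.sqrt 2 / 4 + 3823 / 5040 * Real.sqrt 2 / Real.pi)) := by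
    linear_combination ((n : ℝ) / 16 + 3823 * n / (20160 * Real.pi)) * h22
  rw [hid]
  refine le_trans ?_ hfloor
  have hc0 : 0 ≤ (n : ℝ) * Real.sqrt 2 / 4 := by positivity
  nlinarith [mul_le_mul_of_nonneg_left hIb hc0]

open AnisotropicRotator in
/-- **The floor for the layered hard-core-boson model** (`S = ½`, every `0 < r ≤ 2`): along the even
tori `(ℤ/2kℤ)³`, `liminf_k |Λ_k|⁻² Σ_{x,y} ⟨S¹_xS¹_y + S²_xS²_y⟩_GS ≥ 1/8 - 3823/(10080π) = 0.0042…`,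
uniformly in the interlayer coupling (the saturation value is `S² = 1/4`).
[cite: KLS1988JSP, §3, Theorem] [cite: KLS1988PRL, Theorem, eqs. (7)–(8)] -/
theorem xyLayered_groundOrderParameter_ge_spinHalf {r : ℝ} (hr : 0 < r) (hr2 : r ≤ 2) :
    1 / 8 - 3823 / (10080 * Real.pi) ≤
      liminf (fun k : ℕ => (∑ x ∈ halfOpenBox 3 (2 * k), ∑ y ∈ halfOpenBox 3 (2 * k),
        torusPullback (fun L x y => xyAnisoGroundCorr 0 L 1 (layeredCoupling 1 r) x y +
          xyAnisoGroundCorr 1 L 1 (layeredCoupling 1 r) x y) (2 * k) x y) /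
            ((halfOpenBox 3 (2 * k)).card : ℝ) ^ 2) atTop := by
  have hK : ∀ i, 0 < layeredCoupling 1 r i := fun i => by
    unfold layeredCoupling; split_ifs; exacts [hr, one_pos]
  have h := xyAniso_groundOrderParameter_ge_three hK (layeredCoupling_two_mul_le hr.le hr2) le_rfl
  simp only [Nat.cast_one, one_pow, one_mul] at h
  linarith

/-- The layered floor is positive: `1/8 - 3823/(10080π) > 0` (`π > 3823/1260 = 3.034…`).
[cite: KLS1988JSP, §3, Theorem] -/
theorem layered_groundOrderParameter_floor_pos : (0 : ℝ) < 1 / 8 - 3823 / (10080 * Real.pi) := by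
  have hπ := Real.pi_gt_d2
  have hπ0 := Real.pi_pos
  rw [sub_pos, div_lt_div_iff₀ (by positivity) (by norm_num)]
  nlinarith

/-! ### The floor at low temperature -/

/-- In decimals: `I_{(1,1)} ≤ 0.6951` (`√2/4 + (3823/5040)√2/π = 0.69502…`; the in-line estimate of
`xyLayered_longRangeOrder_thermal_explicit`, recorded as a lemma). [cite: KLS1988PRL, after eq. (8)] -/
theorem anisoKlsIntegral_two_le_decimal : anisoKlsIntegral ![(1 : ℝ), 1] ≤ 6951 / 10000 := by
  have h2 := anisoKlsIntegral_two_le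
  have hs2 : Real.sqrt 2 < 1.41422 := by
    rw [Real.sqrt_lt' (by norm_num)]; norm_num
  have hπ : 1 / Real.pi < 0.31831 := by
    rw [div_lt_iff₀ Real.pi_pos]; nlinarith [Real.pi_gt_d6]
  have hs0 : 0 ≤ Real.sqrt 2 := Real.sqrt_nonneg 2
  have e : Real.sqrt 2 / 4 + 3823 / 5040 * Real.sqrt 2 / Real.pi =
      Real.sqrt 2 * (1 / 4 + 3823 / 5040 * (1 / Real.pi)) := by ring
  rw [e] at h2
  have h3 : Real.sqrt 2 * (1 / 4 + 3823 / 5040 * (1 / Real.pi)) ≤ 6951 / 10000 := by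
    nlinarith [hs2, hπ, hs0, Real.pi_pos, one_div_pos.2 Real.pi_pos]
  exact h2.trans h3

/-- **An explicit floor on the order parameter at low temperature** (Dyson–Lieb–Simon /
Kennedy–Lieb–Shastry for `H_K`, the margin of `anisoKls_margin_thermal` in the statement): for
`d ≥ 3`, `K > 0`, spin `S = n/2 ≥ ½` and every `ρ` with `I_K < ρ < S√2`, there is `β₀ > 0` such that
for all `β ≥ β₀` the Gibbs states of `H_K` on the even tori satisfy
`liminf_k |Λ_k|⁻² Σ_{x,y∈Λ_k} Re⟨S¹_xS¹_y + S²_xS²_y⟩_β ≥ S²/2 - ½(S²/2)^{1/2}ρ = n²/8 - nρ/(4√2)`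
(half the ground-state floor: the other half absorbs the `1/β` terms).
[cite: DysonLiebSimon1978, Thms. 5.1, 5.2] [cite: KLS1988PRL, Theorem, eqs. (7)–(8)]
[cite: KLS1988JSP, p. 1020] -/
theorem xyAniso_thermalOrderParameter_ge (hd3 : 3 ≤ d) {K : Fin d → ℝ} (hK : ∀ i, 0 < K i)
    {n : ℕ} (hn : 1 ≤ n) {ρ : ℝ} (hIρ : anisoKlsIntegral K < ρ) (hρ : ρ < n * Real.sqrt 2 / 2) :
    ∃ β₀ : ℝ, 0 < β₀ ∧ ∀ β : ℝ, β₀ ≤ β →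
      ((n : ℝ) / 2) ^ 2 / 2 - 1 / 2 * Real.sqrt (((n : ℝ) / 2) ^ 2 / 2) * ρ ≤
        liminf (fun k : ℕ => (∑ x ∈ halfOpenBox d (2 * k), ∑ y ∈ halfOpenBox d (2 * k),
          torusPullback (fun L x y => xyAnisoThermalCorr β K L n x y) (2 * k) x y) /
            ((halfOpenBox d (2 * k)).card : ℝ) ^ 2) atTop := by
  have hd : 1 ≤ d := by omega
  haveI : Nonempty (Fin d) := ⟨⟨0, by omega⟩⟩
  set s : ℝ := ((n : ℝ) / 2) ^ 2 / 2 with hs_def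
  set κ : ℝ := ∑ i, K i with hκ_def
  have hn1 : (1 : ℝ) ≤ n := by exact_mod_cast hn
  have hs : 0 < s := by positivity
  have hκ : 0 < κ := Finset.sum_pos (fun i _ => hK i) Finset.univ_nonempty
  have hI0 : 0 ≤ anisoKlsIntegral K := anisoKlsIntegral_nonneg K
  have hρ0 : 0 ≤ ρ := hI0.trans hIρ.le
  have hρ' : ρ < 2 * Real.sqrt s := by rw [hs_def, sqrt_half_sq']; linarith
  -- `R^K ≤ ρ` eventually along the even sides
  have hR : ∀ᶠ k : ℕ in atTop, anisoKlsRiemannSum K (2 * k) ≤ ρ :=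
    (anisoKlsRiemannSum_eventually_le hd3 hK (t := 2 * ρ - anisoKlsIntegral K) (by linarith)).mono
      fun k hk => hk.trans_eq (by ring)
  -- `J^K ≤ 𝒯` eventually (`d ≥ 3`)
  obtain ⟨i₀, -, hi₀⟩ := Finset.exists_min_image Finset.univ K Finset.univ_nonempty
  have hm : 0 < K i₀ := hK i₀
  have hmK : ∀ i, K i₀ ≤ K i := fun i => hi₀ i (Finset.mem_univ i)
  obtain ⟨𝒯, k₀, h𝒯0, h𝒯⟩ :=
    Literature.Barriers.AtomisticToContinuum.BoseGas.torusGreen_zero_eventually_le (d := d) hd3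
  have hJ : ∀ᶠ k : ℕ in atTop, anisoKlsThermalSum K (2 * k) ≤ 𝒯 / K i₀ := by
    filter_upwards [eventually_ge_atTop k₀, eventually_ge_atTop 1] with k hk hk1
    haveI : NeZero (2 * k) := ⟨by omega⟩
    exact (anisoKlsThermalSum_le_torusGreen_div hd (2 * k) hm hmK).trans
      (div_le_div_of_nonneg_right (h𝒯 k hk hk1) hm.le)
  set ℓ : ℝ := Real.log ((n : ℝ) + 1) / (2 * κ) with hℓ_def
  have hℓ : 0 ≤ ℓ := div_nonneg (Real.log_nonneg (by linarith)) (by positivity)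
  obtain ⟨β₀, hβ₀, hmar⟩ := anisoKls_margin_thermal hs hℓ hρ' (div_nonneg h𝒯0 hm.le)
    (fun k => anisoKlsRiemannSum_nonneg K (2 * k)) hR hJ
  refine ⟨β₀, hβ₀, fun β hβ => ?_⟩
  have hβpos : 0 < β := hβ₀.trans_le hβ
  have hev : ∀ᶠ k : ℕ in atTop, ∃ e g : ℝ,
      (∑ x ∈ halfOpenBox d (2 * k), ∑ y ∈ halfOpenBox d (2 * k),
          torusPullback (fun L x y => xyAnisoThermalCorr β K L n x y) (2 * k) x y) /
          ((halfOpenBox d (2 * k)).card : ℝ) ^ 2 = 2 * g ∧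
        e ≤ g + 1 / 2 * Real.sqrt e * anisoKlsRiemannSum K (2 * k) +
          1 / (2 * β) * anisoKlsThermalSum K (2 * k) ∧ s - ℓ / β ≤ e := by
    filter_upwards [eventually_ge_atTop 2] with k hk2
    haveI : NeZero (2 * k) := ⟨by omega⟩
    refine ⟨(∑ i, K i * gibbsDirBondCorr β (xyAnisoTorus (2 * k) n K) 0 i) / κ,
      gibbsStructureFactor β (xyAnisoTorus (2 * k) n K) 0 0 / ((2 * k : ℕ) : ℝ) ^ d,
      xyAniso_thermal_lroSeq_eq β n K k (by omega),
      xyAniso_kls_ineq7_thermal hd (2 * k) n hK ⟨k, by ring⟩ (by omega) hβpos, ?_⟩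
    have hκ0 : κ ≠ 0 := hκ.ne'
    have hβ0 : β ≠ 0 := hβpos.ne'
    rw [le_div_iff₀ hκ, show (s - ℓ / β) * κ = ((n : ℝ) / 2) ^ 2 / 2 * κ -
      Real.log ((n : ℝ) + 1) / (2 * β) by rw [hs_def, hℓ_def]; field_simp]
    exact xyAniso_weightedBondCorr_lower_thermal (2 * k) n K (by omega) hβpos
  obtain ⟨hlim, -⟩ := hmar β hβ _ _ (xyAniso_thermal_lroSeq_le β n K) hev
  rwa [max_eq_left hρ0] at hlim

/-- **The low-temperature floor on three directions, explicit** (`ρ = 869/1250 = 0.6952 ≥ I_{(1,1)}`):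
for every `K > 0` on `ℤ³` with `2 max K ≤ Σᵢ Kᵢ` and every spin `S = n/2 ≥ ½` there is `β₀ > 0`
with `liminf_k |Λ_k|⁻² Σ_{x,y} Re⟨S¹_xS¹_y + S²_xS²_y⟩_β ≥ n²/8 - 869n√2/10000` for all `β ≥ β₀`
(`= 0.0021…` for `S = ½`). [cite: DysonLiebSimon1978, Thms. 5.1, 5.2]
[cite: KLS1988JSP, §3 and p. 1020] [cite: KLS1988PRL, Theorem, eqs. (7)–(8)] -/
theorem xyAniso_thermalOrderParameter_ge_three {K : Fin 3 → ℝ} (hK : ∀ i, 0 < K i)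
    (h2 : ∀ i, 2 * K i ≤ ∑ j, K j) {n : ℕ} (hn : 1 ≤ n) :
    ∃ β₀ : ℝ, 0 < β₀ ∧ ∀ β : ℝ, β₀ ≤ β →
      (n : ℝ) ^ 2 / 8 - 869 * n * Real.sqrt 2 / 10000 ≤
        liminf (fun k : ℕ => (∑ x ∈ halfOpenBox 3 (2 * k), ∑ y ∈ halfOpenBox 3 (2 * k),
          torusPullback (fun L x y => xyAnisoThermalCorr β K L n x y) (2 * k) x y) /
            ((halfOpenBox 3 (2 * k)).card : ℝ) ^ 2) atTop := by
  have hκ : 0 < ∑ i, K i := Finset.sum_pos (fun i _ => hK i) Finset.univ_nonempty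
  have hn1 : (1 : ℝ) ≤ n := by exact_mod_cast hn
  have hs2 := Real.sqrt_nonneg 2
  have hsqrt2 : 1.41421 < Real.sqrt 2 := by
    rw [Real.lt_sqrt (by norm_num)]; norm_num
  have hIρ : anisoKlsIntegral K < 869 / 1250 :=
    ((anisoKlsIntegral_three_le_two hκ h2).trans anisoKlsIntegral_two_le_decimal).trans_lt
      (by norm_num)
  have hρ : (869 / 1250 : ℝ) < n * Real.sqrt 2 / 2 := by nlinarith
  obtain ⟨β₀, hβ₀, h⟩ := xyAniso_thermalOrderParameter_ge le_rfl hK hn hIρ hρ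
  refine ⟨β₀, hβ₀, fun β hβ => ?_⟩
  have hfloor := h β hβ
  rw [sqrt_half_sq'] at hfloor
  refine le_trans (le_of_eq ?_) hfloor
  ring

open AnisotropicRotator in
/-- **The low-temperature floor for the layered hard-core-boson model** (`S = ½`, every
`0 < r ≤ 2`): there is `β₀(r) > 0` with
`liminf_k |Λ_k|⁻² Σ_{x,y} Re⟨S¹_xS¹_y + S²_xS²_y⟩_β ≥ 1/8 - 869√2/10000 = 0.0021…` for all
`β ≥ β₀` (an explicit admissible `β₀(r)`, `r ≤ 1`, is the hypothesis of
`xyLayered_longRangeOrder_thermal_explicit`). [cite: KLS1988JSP, §3 and p. 1020]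
[cite: DysonLiebSimon1978, Thm. 5.2] -/
theorem xyLayered_thermalOrderParameter_ge_spinHalf {r : ℝ} (hr : 0 < r) (hr2 : r ≤ 2) :
    ∃ β₀ : ℝ, 0 < β₀ ∧ ∀ β : ℝ, β₀ ≤ β →
      1 / 8 - 869 * Real.sqrt 2 / 10000 ≤
        liminf (fun k : ℕ => (∑ x ∈ halfOpenBox 3 (2 * k), ∑ y ∈ halfOpenBox 3 (2 * k),
          torusPullback (fun L x y => xyAnisoThermalCorr β (layeredCoupling 1 r) L 1 x y) (2 * k)
            x y) / ((halfOpenBox 3 (2 * k)).card : ℝ) ^ 2) atTop := by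
  have hK : ∀ i, 0 < layeredCoupling 1 r i := fun i => by
    unfold layeredCoupling; split_ifs; exacts [hr, one_pos]
  obtain ⟨β₀, hβ₀, h⟩ :=
    xyAniso_thermalOrderParameter_ge_three hK (layeredCoupling_two_mul_le hr.le hr2) le_rfl
  refine ⟨β₀, hβ₀, fun β hβ => ?_⟩
  have h1 := h β hβ
  simp only [Nat.cast_one, one_pow, mul_one] at h1
  linarith

/-- The low-temperature layered floor is positive: `1/8 - 869√2/10000 > 0`.
[cite: KLS1988JSP, §3 and p. 1020] -/
theorem layered_thermalOrderParameter_floor_pos : (0 : ℝ) < 1 / 8 - 869 * Real.sqrt 2 / 10000 := by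
  have hs2 : Real.sqrt 2 < 1.41422 := by
    rw [Real.sqrt_lt' (by norm_num)]; norm_num
  linarith

end Floor

end Literature.MathematicalPhysics.QuantumLattice
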